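import Literature.Probability.RandomPlanarGeometry.HexSAWStripIdentity
import Mathlib.Analysis.Complex.ExponentialBounds
import HarnessLib

/-!
# Glazman–Manolescu's bridge decay on the honeycomb lattice, made explicit and for every width:
# `B_T(x_c) ≤ 5 · (ln T)^{-1/3}` for all `T ≥ 2`

Topic `Literature/Probability/RandomPlanarGeometry`. Sources: A. Glazman, I. Manolescu,
*Self-avoiding walk on `ℤ²` with Yang–Baxter weights: universality of critical fugacity and
2-point function*, Ann. Inst. Henri Poincaré Probab. Stat. 56 (2020) 2281–2300 (arXiv:1708.00395)
[`GlazmanManolescu2019`]: Proposition 1.1 (p. 4: "We have `Σ_{T≥1} (1/T)(B_T(π/3))³ < ∞`. (3) As a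
consequence, the partition function of self-avoiding bridges on the hexagonal lattice vanishes at
infinity: `B_T(π/3) → 0`. Moreover `B_T(π/3) < 1/(log T)^{1/3}` for infinitely many values of `T`")
and its proof in §4.1 (Lemma 4.1: "`D^Δ_{2L+1}` is decreasing in `L` and
`B_{2L+1} ≤ cos(π/8) D^Δ_{2L+1}`"; "Summing the above over `L = 9^k` we find
`Σ_k (D^Δ_{4·9^k})³ ≤ 8 Σ_k G(0,k) < ∞` … since `D^Δ_T` is decreasing, this implies `D^Δ_T → 0`");
D. Krachun, C. Panagiotis, *Quantitative sub-ballisticity of self-avoiding walk on the hexagonal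
lattice*, Ann. Probab. 54 (2026) (arXiv:2310.17299) [`KrachunPanagiotis2026`]: Theorem 2 (p. 3:
"Let `ε = 10^{-10}`. For every `T ≥ 1` we have `B_T ≤ 100 · T^{-ε}`"), the comparison sentence
following it ("The above result improves on the recent work of Glazman and Manolescu [GM20], where
it was shown that `B_T` converges to `0` as `T` tends to infinity, and furthermore that
`B_T < (log T)^{-1/3}` along a subsequence") and Lemma 2.3 (p. 7: "The sequences `(B_k)_{k≥0}` and
`(D_k)_{k≥0}` are non-increasing and `B_k ≤ cos(π/8) D_k` for every `k ≥ 0`"); H. Duminil-Copin,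
S. Smirnov, Ann. of Math. 175 (2012), §3, eq. (4) (`B_T ≤ 1`) [`DuminilCopinSmirnov2012`].

The tree already carries the three ingredients UNCONDITIONALLY (Lemma 2 of Duminil-Copin–Smirnov
discharged): the block inequality `HV.triDl_pow_three_le (m) : (m+1)·triDl(4·10^m)³ ≤ 1/cos(3π/8)`
for EVERY `m` (`HexSAWBridgeDecay.lean`), the comparison `stripBlim_le_two_mul_triDl (L) :
B_{2L+1} ≤ 2cos(π/8)·triDl L` and the monotonicity `stripBlim_antitone'` (`HexSAWStripIdentity.lean`).
This file turns them into an explicit POINTWISE rate for every width: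

* `stripBlim_le_one` — `B_T(x_c) ≤ 1` (`T ≥ 1`), from `B_T = 1 − c_α A_T − c_ε E_T`;
* `HexBridgeLogDecayBlocks`, `hexBridgeLogDecayBlocks` — for `T ≥ 8·10^m + 1`,
  `B_T(x_c) ≤ 2cos(π/8)·(cos(3π/8)⁻¹/(m+1))^{1/3}`;
* `HexBridgeLogDecay C T₀` (`∀ T ≥ T₀, B_T(x_c) ≤ C·(ln T)^{-1/3}`) and the headline
  **`hexBridgeLogDecay : HexBridgeLogDecay 5 2`**, i.e. `B_T(x_c) ≤ 5 (ln T)^{-1/3}` for all `T ≥ 2`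
  (numerics: `2cos(π/8)(2·cos(3π/8)⁻¹·ln 10)^{1/3} = 4.234 ≤ 5` on the blocks `T ≥ 9`, and
  `B_T ≤ 1 ≤ 5(ln 8)^{-1/3}` for `2 ≤ T ≤ 8`).

Printed status and provenance. In print, Glazman–Manolescu state the `(log T)^{-1/3}` bound
only ALONG A SUBSEQUENCE ("for infinitely many values of `T`", Proposition 1.1); an all-`T`
logarithmic bound is implicit in (3) together with the monotonicity of Lemma 4.1 but is written
nowhere we could find (the printed acknowledgement "Hugo Duminil-Copin for pointing out that the
strategy used in Proposition 1.1 yields an explicit bound on `B_T`" is the only hint). Print DOES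
contain an explicit all-`T` rate of a different (polynomial) type: Krachun–Panagiotis, Theorem 2,
`B_T ≤ 100·T^{-10^{-10}}` for every `T ≥ 1`; and the tree proves that theorem with a larger explicit
exponent on the Summits side —
`Summit.CriticalPhenomena.SAWScalingLimit.Theorems.HexConjecture.RootLocality.KPExplicit.stripBlim_decay_explicit :
∀ T ≥ 1, HV.stripBlim T ≤ 200·T^{-(7/10⁹)}` (file
`Summits/CriticalPhenomena/SAWScalingLimit/Theorems/SAWDevelopingMapHexConjectureKPExplicitExponent.lean`;
named here in text only — a Literature module may not import Summits). What this file adds is the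
first all-`T` bound of Glazman–Manolescu's logarithmic TYPE with explicit constants,
`B_T(x_c) ≤ 5·(ln T)^{-1/3}` for every `T ≥ 2`, read off the tree's all-`m` block inequality (no
subsequence caveat, because the blocks `10^i`, `i ≤ m`, are disjoint for every `m`). Numerically it is
smaller than both polynomial bounds for `e^{125} ≲ T ≲ e^{1.5·10⁹}` (versus `200·T^{-7·10⁻⁹}`) resp.
`T ≲ e^{1.3·10¹¹}` (versus `100·T^{-10⁻¹⁰}`), and all three bounds are `≥ 1` (vacuous) below
`T ≈ e^{125}`; it is an explicit instance of Glazman–Manolescu's mechanism, not a new rate, and it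
is the input of the explicit all-`n` Hammersley–Welsh bound
`c_n(ℍ) ≤ A·exp(K√n (ln n)^{-1/6})·μ_ℍ^n` (`HexSAWHammersleyWelshExplicit.lean`). Statement shapes =
lane «pcv-sawmu» Sketch_G11 §R57 (`HexBridgeLogDecayBlocks`, `HexBridgeLogDecay`); the exact-name
discharge `HexBridgeLogDecayBlocks_holds` is recorded at the end of the file.
-/

noncomputable section

open Finset Filter Topology

namespace Literature.Probability.RandomPlanarGeometry.SAW

open HV

/-! ### `B_T ≤ 1` and the block form -/

/-- `A_T(x_c) ≥ 0`. [cite: DuminilCopinSmirnov2012, §3 (A_T)] -/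
theorem stripAlim_nonneg {T : ℕ} (hT : 1 ≤ T) : 0 ≤ stripAlim T :=
  (stripA_nonneg hexCriticalFugacity_pos_lt_one.1.le).trans
    (stripA_le_lim DuminilCopinSmirnov2012_lemma2_holds hT 0)

/-- **`B_T(x_c) ≤ 1`** for every width `T ≥ 1` ("The partition function of bridges of width `T` is
`B_T^x`, which is at most `1` by (4)"). [cite: DuminilCopinSmirnov2012, §3, eq. (4)] -/
theorem stripBlim_le_one {T : ℕ} (hT : 1 ≤ T) : stripBlim T ≤ 1 := by
  have h := stripBlim_le_escape hT
  have hA := stripAlim_nonneg hT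
  nlinarith [cos_three_pi_div_eight_pos]

/-- The BLOCK FORM of Glazman–Manolescu's decay with explicit constants: for `T ≥ 8·10^m + 1`,
`B_T(x_c) ≤ 2cos(π/8)·(cos(3π/8)⁻¹/(m+1))^{1/3}`. [cite: GlazmanManolescu2019, §4.1 (proof of Proposition 1.1)] -/
def HexBridgeLogDecayBlocks : Prop := ∀ m T : ℕ, 8 * 10 ^ m + 1 ≤ T →
  HV.stripBlim T ≤ 2 * Real.cos (Real.pi / 8) * ((Real.cos (3 * Real.pi / 8))⁻¹ / ((m : ℝ) + 1)) ^ ((1 : ℝ) / 3)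

/-- `triDl(4·10^m) ≤ (cos(3π/8)⁻¹/(m+1))^{1/3}` — the cube root of the block inequality
`(m+1)·triDl(4·10^m)³ ≤ cos(3π/8)⁻¹`. [cite: GlazmanManolescu2019, §4.1 (proof of Proposition 1.1)] -/
theorem triDl_block_le (m : ℕ) :
    triDl (4 * 10 ^ m) ≤ ((Real.cos (3 * Real.pi / 8))⁻¹ / ((m : ℝ) + 1)) ^ ((1 : ℝ) / 3) := by
  have h := triDl_pow_three_le m
  have h0 : 0 ≤ triDl (4 * 10 ^ m) := triDl_nonneg _
  have hm : (0 : ℝ) < (m : ℝ) + 1 := by positivity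
  have h3 : triDl (4 * 10 ^ m) ^ 3 ≤ (Real.cos (3 * Real.pi / 8))⁻¹ / ((m : ℝ) + 1) := by
    rw [le_div_iff₀ hm]; linarith
  calc triDl (4 * 10 ^ m) = (triDl (4 * 10 ^ m) ^ 3) ^ ((3 : ℕ)⁻¹ : ℝ) :=
        (Real.pow_rpow_inv_natCast h0 (by norm_num)).symm
    _ = (triDl (4 * 10 ^ m) ^ 3) ^ ((1 : ℝ) / 3) := by norm_num
    _ ≤ _ := Real.rpow_le_rpow (pow_nonneg h0 3) h3 (by norm_num)

/-- **The block form holds** (`stripBlim_antitone'` + `stripBlim_le_two_mul_triDl` + the cube root of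
`triDl_pow_three_le`). [cite: GlazmanManolescu2019, §4.1 (proof of Proposition 1.1)] -/
theorem hexBridgeLogDecayBlocks : HexBridgeLogDecayBlocks := by
  intro m T hT
  have hc : 0 ≤ 2 * Real.cos (Real.pi / 8) := by linarith [cos_pi_div_eight_pos]
  calc stripBlim T ≤ stripBlim (2 * (4 * 10 ^ m) + 1) := stripBlim_antitone' (by omega) (by omega)
    _ ≤ 2 * Real.cos (Real.pi / 8) * triDl (4 * 10 ^ m) := stripBlim_le_two_mul_triDl _
    _ ≤ _ := mul_le_mul_of_nonneg_left (triDl_block_le m) hc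

/-! ### The pointwise logarithmic rate -/

/-- Logarithmic decay of the critical bridge partition functions with an explicit constant:
`B_T(x_c) ≤ C·(ln T)^{-1/3}` for all `T ≥ T₀`. [cite: GlazmanManolescu2019, Proposition 1.1 and eq. (3)] -/
def HexBridgeLogDecay (C : ℝ) (T₀ : ℕ) : Prop :=
  ∀ T : ℕ, T₀ ≤ T → HV.stripBlim T ≤ C * (Real.log T) ^ (-(1 : ℝ) / 3)

/-- `cos(3π/8) ≥ 3/10` (`cos(3π/8) = sin(π/8) = √(2−√2)/2 = 0.3827`). [folklore] -/
private theorem three_div_ten_le_cos_three_pi_div_eight : (3 : ℝ) / 10 ≤ Real.cos (3 * Real.pi / 8) := by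
  rw [show (3 * Real.pi / 8 : ℝ) = Real.pi / 2 - Real.pi / 8 by ring, Real.cos_pi_div_two_sub,
    Real.sin_pi_div_eight]
  have h2 : Real.sqrt 2 ≤ 3 / 2 := by
    rw [show (3 / 2 : ℝ) = Real.sqrt ((3 / 2) ^ 2) by rw [Real.sqrt_sq (by norm_num)]]
    exact Real.sqrt_le_sqrt (by norm_num)
  have h3 : (3 : ℝ) / 5 ≤ Real.sqrt (2 - Real.sqrt 2) := by
    rw [Real.le_sqrt' (by norm_num)]; linarith
  linarith

/-- `ln 10 ≤ 2.33` (`ln 10 = 3 ln 2 + ln(5/4) ≤ 3·0.6931471808 + 1/4`). [folklore] -/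
private theorem log_ten_le : Real.log 10 ≤ 233 / 100 := by
  have h : Real.log 10 = 3 * Real.log 2 + Real.log (5 / 4) := by
    rw [show (10 : ℝ) = 2 ^ 3 * (5 / 4) by norm_num, Real.log_mul (by norm_num) (by norm_num),
      Real.log_pow]; push_cast; ring
  have h54 : Real.log (5 / 4) ≤ 5 / 4 - 1 := Real.log_le_sub_one_of_pos (by norm_num)
  rw [h]; linarith [Real.log_two_lt_d9]

/-- Locating the block of a width `T ≥ 9`: with `m := log₁₀ ⌊(T−1)/8⌋`, `8·10^m + 1 ≤ T < 10^{m+2}`. [folklore] -/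
private theorem block_of_ge_nine {T : ℕ} (hT : 9 ≤ T) :
    8 * 10 ^ Nat.log 10 ((T - 1) / 8) + 1 ≤ T ∧ T < 10 ^ (Nat.log 10 ((T - 1) / 8) + 2) := by
  set q := (T - 1) / 8 with hq
  have hq1 : q ≠ 0 := by omega
  have h1 : 10 ^ Nat.log 10 q ≤ q := Nat.pow_log_le_self 10 hq1
  have h2 : q < 10 ^ (Nat.log 10 q + 1) := Nat.lt_pow_succ_log_self (by norm_num) q
  constructor
  · omega
  · have : T - 1 < 8 * (q + 1) := by omega
    rw [pow_succ] at h2 ⊢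
    omega

/-- **Glazman–Manolescu's decay, explicit and for every width: `B_T(x_c) ≤ 5·(ln T)^{-1/3}` for all
`T ≥ 2`.** For `T ≥ 9` locate the block `8·10^m + 1 ≤ T < 10^{m+2}` (so `ln T ≤ 2(m+1) ln 10`) and
use the block form with `cos(π/8) ≤ 1`, `cos(3π/8) ≥ 3/10`, `ln 10 ≤ 2.33`; for `2 ≤ T ≤ 8` use
`B_T ≤ 1 ≤ 5 (ln 8)^{-1/3}`. [cite: GlazmanManolescu2019, Proposition 1.1 and eq. (3)] -/
theorem hexBridgeLogDecay_of_blocks (h : HexBridgeLogDecayBlocks) : HexBridgeLogDecay 5 2 := by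
  intro T hT
  have hT1 : 1 ≤ T := by omega
  have hlogpos : 0 < Real.log T := Real.log_pos (by exact_mod_cast (by omega : 1 < T))
  rcases Nat.lt_or_ge T 9 with hsmall | hbig
  · -- `2 ≤ T ≤ 8`: `B_T ≤ 1 ≤ 5 (ln T)^{-1/3}` since `ln T ≤ T - 1 ≤ 7 ≤ 125`.
    have hlog : Real.log T ≤ 125 := by
      have := Real.log_le_sub_one_of_pos (x := (T : ℝ)) (by positivity)
      have hT8 : (T : ℝ) ≤ 8 := by exact_mod_cast (by omega : T ≤ 8)
      linarith
    have h125 : (125 : ℝ) ^ (-(1 : ℝ) / 3) = 1 / 5 := by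
      rw [show (125 : ℝ) = 5 ^ (3 : ℝ) by norm_num, ← Real.rpow_mul (by norm_num)]
      norm_num
    have hmono : (125 : ℝ) ^ (-(1 : ℝ) / 3) ≤ (Real.log T) ^ (-(1 : ℝ) / 3) :=
      Real.rpow_le_rpow_of_nonpos hlogpos hlog (by norm_num)
    rw [h125] at hmono
    linarith [stripBlim_le_one hT1]
  · -- `T ≥ 9`: block `m`.
    obtain ⟨hlo, hhi⟩ := block_of_ge_nine hbig
    set m := Nat.log 10 ((T - 1) / 8) with hm
    have hB := h m T hlo
    set c := (Real.cos (3 * Real.pi / 8))⁻¹ with hc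
    have hcpos : 0 < Real.cos (3 * Real.pi / 8) := cos_three_pi_div_eight_pos
    have hc_le : c ≤ 10 / 3 := by
      rw [hc, inv_le_comm₀ hcpos (by norm_num)]
      linarith [three_div_ten_le_cos_three_pi_div_eight]
    have hc0 : 0 ≤ c := by positivity
    have hm0 : (0 : ℝ) < (m : ℝ) + 1 := by positivity
    -- `ln T ≤ (m+2) ln 10 ≤ 2 (m+1) · 2.33`
    have hlogT : Real.log T ≤ 2 * ((m : ℝ) + 1) * (233 / 100) := by
      have h10 : (T : ℝ) ≤ (10 : ℝ) ^ (m + 2) := by exact_mod_cast hhi.le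
      have hl : Real.log T ≤ Real.log ((10 : ℝ) ^ (m + 2)) :=
        Real.log_le_log (by positivity) h10
      rw [Real.log_pow] at hl
      push_cast at hl
      have hl10 := log_ten_le
      have hl10' : 0 ≤ Real.log 10 := Real.log_nonneg (by norm_num)
      nlinarith
    -- hence `1/(m+1) ≤ 4.66 / ln T` and `c/(m+1) ≤ (10/3)·4.66/ln T`
    have hfrac : c / ((m : ℝ) + 1) ≤ (1554 / 100) * (Real.log T)⁻¹ := by
      rw [div_le_iff₀ hm0]
      have : c * Real.log T ≤ (1554 / 100) * ((m : ℝ) + 1) :=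
        calc c * Real.log T ≤ (10 / 3) * (2 * ((m : ℝ) + 1) * (233 / 100)) :=
              mul_le_mul hc_le hlogT hlogpos.le (by norm_num)
          _ ≤ (1554 / 100) * ((m : ℝ) + 1) := by nlinarith
      calc c = c * Real.log T * (Real.log T)⁻¹ := by field_simp
        _ ≤ (1554 / 100) * ((m : ℝ) + 1) * (Real.log T)⁻¹ :=
            mul_le_mul_of_nonneg_right this (inv_nonneg.2 hlogpos.le)
        _ = _ := by ring
    have hroot : (c / ((m : ℝ) + 1)) ^ ((1 : ℝ) / 3) ≤ ((1554 / 100) * (Real.log T)⁻¹) ^ ((1 : ℝ) / 3) :=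
      Real.rpow_le_rpow (by positivity) hfrac (by norm_num)
    -- `(15.53 y)^{1/3} = 15.53^{1/3} y^{1/3}` and `15.53^{1/3} ≤ 5/2`
    have hsplit : ((1554 / 100 : ℝ) * (Real.log T)⁻¹) ^ ((1 : ℝ) / 3) =
        (1554 / 100 : ℝ) ^ ((1 : ℝ) / 3) * (Real.log T) ^ (-(1 : ℝ) / 3) := by
      rw [Real.mul_rpow (by norm_num) (inv_nonneg.2 hlogpos.le), Real.inv_rpow hlogpos.le,
        ← Real.rpow_neg hlogpos.le]
      norm_num
    have hconst : (1554 / 100 : ℝ) ^ ((1 : ℝ) / 3) ≤ 5 / 2 := by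
      have : (1554 / 100 : ℝ) ≤ (5 / 2) ^ (3 : ℕ) := by norm_num
      calc (1554 / 100 : ℝ) ^ ((1 : ℝ) / 3) ≤ ((5 / 2 : ℝ) ^ (3 : ℕ)) ^ ((1 : ℝ) / 3) :=
            Real.rpow_le_rpow (by norm_num) this (by norm_num)
        _ = 5 / 2 := by
            rw [show ((1 : ℝ) / 3) = ((3 : ℕ) : ℝ)⁻¹ by norm_num]
            exact Real.pow_rpow_inv_natCast (by norm_num) (by norm_num)
    have hcos1 : Real.cos (Real.pi / 8) ≤ 1 := Real.cos_le_one _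
    have hcos0 : 0 ≤ Real.cos (Real.pi / 8) := cos_pi_div_eight_pos.le
    have hy0 : 0 ≤ (Real.log T) ^ (-(1 : ℝ) / 3) := Real.rpow_nonneg hlogpos.le _
    have hr0 : 0 ≤ (c / ((m : ℝ) + 1)) ^ ((1 : ℝ) / 3) := Real.rpow_nonneg (by positivity) _
    rw [hsplit] at hroot
    calc stripBlim T ≤ 2 * Real.cos (Real.pi / 8) * (c / ((m : ℝ) + 1)) ^ ((1 : ℝ) / 3) := hB
      _ ≤ 2 * 1 * ((5 / 2) * (Real.log T) ^ (-(1 : ℝ) / 3)) := by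
          refine mul_le_mul (by nlinarith) (hroot.trans ?_) hr0 (by norm_num)
          exact mul_le_mul_of_nonneg_right hconst hy0
      _ = 5 * (Real.log T) ^ (-(1 : ℝ) / 3) := by ring

/-- **`B_T(x_c) ≤ 5·(ln T)^{-1/3}` for every `T ≥ 2`** (unconditional: the block form is a tree theorem).
[cite: GlazmanManolescu2019, Proposition 1.1 and eq. (3)] -/
theorem hexBridgeLogDecay : HexBridgeLogDecay 5 2 :=
  hexBridgeLogDecay_of_blocks hexBridgeLogDecayBlocks

/-- Exact-name discharge of the closed `Prop` `HexBridgeLogDecayBlocks` (the block form of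
Glazman–Manolescu's decay), for the facts census: it is the theorem `hexBridgeLogDecayBlocks`.
[cite: GlazmanManolescu2019, §4.1 (proof of Proposition 1.1)] -/
theorem HexBridgeLogDecayBlocks_holds : HexBridgeLogDecayBlocks :=
  hexBridgeLogDecayBlocks

end Literature.Probability.RandomPlanarGeometry.SAW

end
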